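import Literature.Analysis.Distribution.SchwartzFourierBilinForm
import HarnessLib

/-!
# The Fourier transform for a non-degenerate pairing and a Haar measure, as a continuous operator on `𝓢`

`Literature/Analysis/Distribution` support file (everything proved). The companion file
`SchwartzFourierBilinForm` proves that for `f ∈ 𝓢(E, F)`, an additive Haar measure `μ` on the finite-dimensional
real space `E` and a non-degenerate bilinear form `B` on `E` the function `w ↦ ∫ 𝐞(-B(v, w)) f(v) dμ(v)` is again a
Schwartz function — as an EXISTENCE statement. Consumers that need the dependence on `f` to be a CONTINUOUS LINEAR
operator of the Fréchet space `𝓢(E, F)` (e.g. the continuity bookkeeping of the adelic Weyl-element operator on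
`𝓢((K ⊗ ℝ)^ι) ⊗ 𝒮((𝔸_K^∞)^ι)`) get it here:

* `SchwartzMap.bilinFourierCLM μ B hB : 𝓢(E, F) →L[ℂ] 𝓢(E, F)` — the same operator `c · ((𝓕 (f ∘ T⁻¹)) ∘ S)` built
  from Mathlib's `SchwartzMap.fourierTransformCLM` and `SchwartzMap.compCLMOfContinuousLinearEquiv` along a choice of
  isomorphisms `T, S : E ≃ ℝ^d` with `B(v, w) = ⟪T v, S w⟫` (`exists_continuousLinearEquiv_bilinForm_eq_inner`);
* `SchwartzMap.bilinFourierCLM_apply` — **`bilinFourierCLM μ B hB f w = ∫ 𝐞(-B(v, w)) f(v) dμ(v)`**, so the operator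
  does not depend on the choices.

[folklore]

## References

* J. Tate, in Cassels–Fröhlich (eds.), *Algebraic Number Theory* (1967), Ch. XV, §2.2, §3.2 [CasselsFrohlichANT1967].
* L. Hörmander, *The Analysis of Linear Partial Differential Operators I*, Thm. 7.1.5 [folklore].
-/

noncomputable section

open MeasureTheory MeasureTheory.Measure Real
open scoped FourierTransform SchwartzMap RealInnerProductSpace ENNReal NNReal

namespace Literature.Analysis.Distribution

variable {E : Type*} [NormedAddCommGroup E] [NormedSpace ℝ E] [FiniteDimensional ℝ E] [MeasurableSpace E]
  [BorelSpace E] {F : Type*} [NormedAddCommGroup F] [NormedSpace ℂ F]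

/-- **The Fourier transform attached to a Haar measure `μ` and a non-degenerate bilinear form `B` on `E`, as a
continuous linear operator of `𝓢(E, F)`**: `c · ((𝓕 (f ∘ T⁻¹)) ∘ S)` for a chosen pair of isomorphisms
`T, S : E ≃ ℝ^d` with `B(v, w) = ⟪T v, S w⟫` and `c` the Haar scalar factor of `T_* μ` against the volume of `ℝ^d`
(its values are computed, choice-free, by `bilinFourierCLM_apply`). [folklore] -/
def SchwartzMap.bilinFourierCLM (μ : Measure E) [μ.IsAddHaarMeasure] (B : LinearMap.BilinForm ℝ E)
    (hB : B.Nondegenerate) : 𝓢(E, F) →L[ℂ] 𝓢(E, F) :=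
  (((μ.map (exists_continuousLinearEquiv_bilinForm_eq_inner B hB).choose).addHaarScalarFactor
      (volume : Measure (EuclideanSpace ℝ (Fin (Module.finrank ℝ E)))) : ℝ) : ℂ) •
    ((SchwartzMap.compCLMOfContinuousLinearEquiv ℂ
        (exists_continuousLinearEquiv_bilinForm_eq_inner B hB).choose_spec.choose).comp
      ((SchwartzMap.fourierTransformCLM ℂ).comp
        (SchwartzMap.compCLMOfContinuousLinearEquiv ℂ
          (exists_continuousLinearEquiv_bilinForm_eq_inner B hB).choose.symm)))

/-- **`bilinFourierCLM μ B hB f w = ∫ 𝐞(-B(v, w)) f(v) dμ(v)`** (the computation of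
`SchwartzMap.exists_eq_integral_fourierChar_bilinForm`, now for the packaged operator). [folklore] -/
theorem SchwartzMap.bilinFourierCLM_apply (μ : Measure E) [μ.IsAddHaarMeasure] (B : LinearMap.BilinForm ℝ E)
    (hB : B.Nondegenerate) (f : 𝓢(E, F)) (w : E) :
    SchwartzMap.bilinFourierCLM μ B hB f w = ∫ v, 𝐞 (-(B v w)) • f v ∂μ := by
  set T := (exists_continuousLinearEquiv_bilinForm_eq_inner B hB).choose with hT
  set S := (exists_continuousLinearEquiv_bilinForm_eq_inner B hB).choose_spec.choose with hS
  have hTS : ∀ v w, B v w = ⟪T v, S w⟫ :=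
    (exists_continuousLinearEquiv_bilinForm_eq_inner B hB).choose_spec.choose_spec
  set V := EuclideanSpace ℝ (Fin (Module.finrank ℝ E)) with hV
  set c : ℝ≥0 := (μ.map T).addHaarScalarFactor (volume : Measure V) with hc
  have hμ : μ.map T = c • (volume : Measure V) := isAddLeftInvariant_eq_smul _ _
  -- unfold the operator at `f`, `w`
  have happ : SchwartzMap.bilinFourierCLM μ B hB f w =
      (c : ℂ) • (SchwartzMap.compCLMOfContinuousLinearEquiv ℂ S
        (SchwartzMap.fourierTransformCLM ℂ (SchwartzMap.compCLMOfContinuousLinearEquiv ℂ T.symm f))) w := rfl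
  rw [happ, SchwartzMap.compCLMOfContinuousLinearEquiv_apply, Function.comp_apply,
    SchwartzMap.fourierTransformCLM_apply, SchwartzMap.fourier_coe, Real.fourier_eq]
  -- change variables `v = T⁻¹ x` on the right
  have hchange : ∫ v, 𝐞 (-(B v w)) • f v ∂μ = ∫ x : V, 𝐞 (-⟪x, S w⟫) • f (T.symm x) ∂(μ.map T) := by
    rw [show (⇑T : E → V) = ⇑T.toHomeomorph.toMeasurableEquiv by
      rw [Homeomorph.toMeasurableEquiv_coe]; rfl, integral_map_equiv]
    refine integral_congr_ae (Filter.Eventually.of_forall fun v => ?_)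
    simp only [Homeomorph.toMeasurableEquiv_coe, ContinuousLinearEquiv.coe_toHomeomorph,
      ContinuousLinearEquiv.symm_apply_apply, hTS]
  rw [hchange, hμ, integral_smul_nnreal_measure, NNReal.smul_def, Complex.coe_smul]
  rfl

end Literature.Analysis.Distribution
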